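/-
Copyright (c) 2026 the pub-hodgecm-mathlib formalisation cell (harness21).  Prover seat hodgecm-mathlib-K2E4-p10 (g7), Track B ∕ K2-LIT, h413 = `stmt-HodgeConjecture-24833`,
line `K2_E1_TraceFormulaBeta`, 5Res ROADCARD «ENDGAME BY FAMILIES» §3′ M2 v2 (K2E1-plan (g7), (204)∕(207)∕(232)∕(234)) file D4′c (SD) part 4b: the SELF-DUAL-BLOCK CAPSTONE ON LETTERS —
parts 1∕2∕3∕4a assembled: from the vector two-term formula on `Re z = σ₀` + entry Maass–Selberg letters + FE∕adjoint letters + positivity of the residues, the Plancherel isometry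
`closure span {x_i} ≅ (⊕_{c∈S} V) ⊕ L²((0,∞); V)`-model.
-/
import Summits.HodgeConjecture.HodgeConjecture.Theorems.K2E1PseudoEisensteinContourShiftVector           -- ★ part 2 p860258: `pseudoEisenstein_contourShift_vector_of_letters`, `integrable_vectorIntegrand_vertical`
import Summits.HodgeConjecture.HodgeConjecture.Theorems.K2E1PseudoEisensteinPlancherelIsometryOperator    -- ★ part 1 p860222: `axis_integrand_eq_op`, `exists_linearIsometry_of_twoTerm_gram`, `range_linearIsometry_of_twoTerm_gram`
import Summits.HodgeConjecture.HodgeConjecture.Theorems.K2E1OperatorUnitaryAxisOfFE                      -- ★ part 3 p860275: `hc1_hcs_of_fe_of_adj`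
import Summits.HodgeConjecture.HodgeConjecture.Theorems.K2E1PositiveResidueGramModel                    -- ★ part 4a p860298: `exists_gram_of_nonneg_finset`
import Summits.HodgeConjecture.HodgeConjecture.Theorems.K2E1ChiSectionPlancherelKTypeCMTwo                -- ★ (OD) p860123: `continuous_mellin_neg_axis`, `memLp_two_mellin_neg_axis`
import HarnessLib

/-!
# D4′c (SD) part 4b — `K2E1ChiSectionPlancherelSelfDualOfLetters`: THE PLANCHEREL ISOMETRY OF A SELF-DUAL BLOCK ON LETTERS —
# `closure span {x_i} →ₗᵢ (⊕_{c∈S} V) ⊕₂ L²((0,∞); V)`, `U x_i = ((√C·R_c^{1/2} Ψ̂_i(−c))_c, √(C∕2π)·[Ψ̂_i(−(½+it)) + M(½−it)Ψ̂_i(−(½−it))])`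

Track B ∕ K2-LIT, crux h413 = `stmt-HodgeConjecture-24833`, route of record `HCCMUnconditional`; cell `hodgecm-mathlib`, squad K2, ENGINE E1.  THEOREMS ONLY (no `def`, no `instance`,
no `notation`, no named-fact hypothesis, no `sorry`; default heartbeats); lane `--supports stmt-HodgeConjecture-24833 --as helper` (count-neutral).  GENERIC: the family `x_i` lives in
any complex inner-product space `H` (E1: the classes `[θ_{Ψ_i}] ∈ L²(X, μ)` of a self-dual `χ`-family at a `K`-type), `V` is any finite-dimensional complex inner-product space (E1: an
`L²(K_U)`-model of `V(χ, K′, ω)`), so every automorphic letter plugs in BY NAME later.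
THE MATHEMATICS ([MoeglinWaldspurger1995, II.2.1–II.2.4, IV.1.10–IV.1.11, IV.3.12]; [Langlands1976, §7]; [Iwaniec2002, §7.3]).  Section fields `Ψ_i = Σ_a f_{i,a} ⊗ φ_a` (`f_{i,a} ∈
C²_c((0,∞))`, `φ_a ∈ V` a finite spanning family), transforms `Ψ̂_i(w) = Σ_a f̃_{i,a}(w)•φ_a`.  LETTERS: (two-term) the Gram form of the `x_i` on the line `Re z = σ₀ > ½` in vector currency
`⟪x_i, x_j⟫ = C·(2π)⁻¹∫_ℝ (⟪Ψ̂_i(−(1−z̄)), Ψ̂_j(−z)⟫ + ⟪Ψ̂_i(−z̄), M(z)Ψ̂_j(−z)⟫) dy` (H-χ (SD) ∘ sesquilinear expansion); (MS entries) for every `(a,b)`: `z ↦ ⟪φ_b, M(z)φ_a⟫` holomorphic on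
an open `U ⊇ {½ ≤ Re z ≤ σ₀}` off a finset `S ⊂ (½, σ₀)` of real poles, residues `⟪φ_b, R_c φ_a⟫`, strip bound at `|Im z| ≥ 1` ((b)-block at `(K′, ω)`); (FE∕adjoint) `M(1−z)M(z) = 1` and
`⟪x, M(z)y⟫ = ⟪M(z̄)x, y⟫` off a co-discrete `P`, `t ↦ M(½+it)v` continuous (C3 + hconj + axis regularity); (positivity) `R_c` symmetric with `re ⟪v, R_c v⟫ ≥ 0` (MW IV.3.12 (b)).  THEN:
★ part 2 moves each Gram entry to the axis picking up `C·Σ_c ⟪Ψ̂_i(−c), R_c Ψ̂_j(−c)⟫`; ★ part 4a realises that residue block as `⟪r_i, r_j⟫` in `⊕_{c∈S} V`; ★ part 3 turns (FE∕adjoint)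
into unitarity + adjoint-reflection of `c(t) = M(½+it)`; ★ part 1 folds the axis integral into `⟪U_i, U_j⟫_{L²((0,∞);V)}`, `U_i(t) = Ψ̂_i(−(½+it)) + M(½−it)Ψ̂_i(−(½−it))` (in `L²` since
`f̃ ∈ L²` ★ (OD) §1 and `M(½−it)` is isometric), and ★ P3a gives the LINEAR ISOMETRY **`U : closure span {x_i} →ₗᵢ[ℂ] (⊕_{c∈S} V) ⊕₂ L²((0,∞); V)`**, `U x_i = (r_i, √(C∕2π)•[U_i])`, with
`range U = closure span` when `H` is complete — the (SD) block `Θ_χ^{(K′,ω)} ≅ (⊕_j Res_{χ,j}) ⊕ 𝓜_χ^{cont}` of ROADCARD §3′ D4′c, on letters.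
* §1 `norm_map_eq_of_inner_map_map` (unitary ⇒ isometric), `continuous_transform`, `memLp_two_transform` (`t ↦ Ψ̂_i(−(½+it))` continuous and `L²`), `memLp_two_axisModel_selfDual`
  (`U_i ∈ L²((0,∞); V)`).
* §2 HEAD **`exists_linearIsometry_selfDual_of_letters`** (+ `range` clause for complete `H`).
HONEST LABEL: HC_CM is proved only modulo the 7 printed citations (2 remaining named inputs: hLiu418 = `stmt-HodgeConjecture-24832`, h413 = `stmt-HodgeConjecture-24833`) until rung 0
closes; this file asserts no named fact, closes no socket; count-neutral; letters as listed (two-term Gram, MS entries, FE∕adjoint∕axis continuity, residue positivity).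

## References
* [MoeglinWaldspurger1995] C. Mœglin, J.-L. Waldspurger, *Spectral decomposition and Eisenstein series* (1995), II.2.1–II.2.4, IV.1.10–IV.1.11, IV.3.12.
* [Langlands1976] R. P. Langlands, *On the Functional Equations Satisfied by Eisenstein Series*, LNM 544 (1976), §7.
* [Iwaniec2002] H. Iwaniec, *Spectral Methods of Automorphic Forms* (2nd ed., 2002), §7.3.
-/

set_option autoImplicit false
set_option linter.dupNamespace false  -- the mandated namespace repeats the summit's segment (`HodgeConjecture.HodgeConjecture`)

noncomputable section

open MeasureTheory Measure Set Filter Topology Complex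
open scoped Real ComplexConjugate InnerProductSpace BigOperators
open Summit.HodgeConjecture.HodgeConjecture.Cruxes.H413.K2E1PseudoEisensteinContourShiftVector (pseudoEisenstein_contourShift_vector_of_letters integrable_vectorIntegrand_vertical)
open Summit.HodgeConjecture.HodgeConjecture.Cruxes.H413.K2E1PseudoEisensteinPlancherelIsometryOperator (axis_integrand_eq_op exists_linearIsometry_of_twoTerm_gram
  range_linearIsometry_of_twoTerm_gram)
open Summit.HodgeConjecture.HodgeConjecture.Cruxes.H413.K2E1OperatorUnitaryAxisOfFE (hc1_hcs_of_fe_of_adj)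
open Summit.HodgeConjecture.HodgeConjecture.Cruxes.H413.K2E1PositiveResidueGramModel (exists_gram_of_nonneg_finset)
open Summit.HodgeConjecture.HodgeConjecture.Cruxes.H413.K2E1ChiSectionPlancherelKTypeCMTwo (continuous_mellin_neg_axis memLp_two_mellin_neg_axis)
open Summit.HodgeConjecture.HodgeConjecture.Cruxes.H413.K2E1PlancherelIsometryOfForm (mem_topologicalClosure_span)

namespace Summit.HodgeConjecture.HodgeConjecture.Cruxes.H413.K2E1ChiSectionPlancherelSelfDualOfLetters

variable {V : Type*} [NormedAddCommGroup V] [InnerProductSpace ℂ V]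

/-! ## §1 The axis model vector `U_i(t) = Ψ̂_i(−(½+it)) + M(½−it)Ψ̂_i(−(½−it))` is in `L²((0,∞); V)` -/

/-- An inner-product-preserving map is norm-preserving. [folklore] -/
theorem norm_map_eq_of_inner_map_map {c : V → V} (hc1 : ∀ v v' : V, ⟪c v, c v'⟫_ℂ = ⟪v, v'⟫_ℂ) (v : V) : ‖c v‖ = ‖v‖ := by
  have h2 : ‖c v‖ ^ 2 = ‖v‖ ^ 2 := by rw [@norm_sq_eq_re_inner ℂ, @norm_sq_eq_re_inner ℂ, hc1 v v]
  exact (sq_eq_sq₀ (norm_nonneg _) (norm_nonneg _)).1 h2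

/-- **The transform `t ↦ Ψ̂(−(½+it)) = Σ_a f̃_a(−(½+it))•φ_a` is continuous** (★ (OD) §1 `continuous_mellin_neg_axis` per entry). [cite: Titchmarsh1948, §1.29] -/
theorem continuous_transform {α : Type*} [Fintype α] {f : α → ℝ → ℂ} (hf : ∀ a, ContDiff ℝ 2 (f a)) (hfs : ∀ a, HasCompactSupport (f a)) (hf0 : ∀ a, tsupport (f a) ⊆ Ioi 0)
    (φ : α → V) : Continuous fun t : ℝ => ∑ a, mellin (f a) (-((((1 / 2 : ℝ)) : ℂ) + t * I)) • φ a :=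
  continuous_finsetSum _ fun a _ => (continuous_mellin_neg_axis (hf a).continuous (hfs a) (hf0 a)).smul continuous_const

/-- **The transform `t ↦ Ψ̂(−(½+it))` is in `L²(ℝ; V)`** (★ (OD) §1 `memLp_two_mellin_neg_axis` per entry). [cite: Titchmarsh1948, Thm 71–72] -/
theorem memLp_two_transform {α : Type*} [Fintype α] {f : α → ℝ → ℂ} (hf : ∀ a, ContDiff ℝ 2 (f a)) (hfs : ∀ a, HasCompactSupport (f a)) (hf0 : ∀ a, tsupport (f a) ⊆ Ioi 0)
    (φ : α → V) : MemLp (fun t : ℝ => ∑ a, mellin (f a) (-((((1 / 2 : ℝ)) : ℂ) + t * I)) • φ a) 2 (volume : Measure ℝ) :=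
  memLp_finsetSum _ fun a _ => MemLp.of_le_mul (c := ‖φ a‖) (memLp_two_mellin_neg_axis (hf a) (hfs a) (hf0 a))
    (((continuous_mellin_neg_axis (hf a).continuous (hfs a) (hf0 a)).smul continuous_const).aestronglyMeasurable)
    (Eventually.of_forall fun t => by rw [norm_smul, mul_comm])

/-- **`U(t) = Ψ̂(−(½+it)) + M(½−it)Ψ̂(−(½−it)) ∈ L²((0,∞); V)`** when `M(½+it)` preserves inner products (isometric, so `‖M(½−it)Ψ̂(−(½−it))‖ = ‖Ψ̂(−(½−it))‖`, reflection is
measure-preserving) and `t ↦ M(½+it)v` is continuous for every `v` (measurability through the finite expansion `Σ_a f̃_a•M φ_a`). [cite: MoeglinWaldspurger1995, IV.3.12] -/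
theorem memLp_two_axisModel_selfDual {α : Type*} [Fintype α] {f : α → ℝ → ℂ} (hf : ∀ a, ContDiff ℝ 2 (f a)) (hfs : ∀ a, HasCompactSupport (f a)) (hf0 : ∀ a, tsupport (f a) ⊆ Ioi 0)
    (φ : α → V) (M : ℂ → V →ₗ[ℂ] V)
    (hc1 : ∀ (t : ℝ) (v v' : V), ⟪M ((((1 / 2 : ℝ)) : ℂ) + t * I) v, M ((((1 / 2 : ℝ)) : ℂ) + t * I) v'⟫_ℂ = ⟪v, v'⟫_ℂ)
    (hcont : ∀ v : V, Continuous fun t : ℝ => M ((((1 / 2 : ℝ)) : ℂ) + t * I) v) :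
    MemLp (fun t : ℝ => (∑ a, mellin (f a) (-((((1 / 2 : ℝ)) : ℂ) + t * I)) • φ a) +
      M ((((1 / 2 : ℝ)) : ℂ) + ((-t : ℝ) : ℂ) * I) (∑ a, mellin (f a) (-((((1 / 2 : ℝ)) : ℂ) + ((-t : ℝ) : ℂ) * I)) • φ a)) 2 ((volume : Measure ℝ).restrict (Ioi 0)) := by
  have hA := memLp_two_transform hf hfs hf0 φ
  -- the reflected transform is in `L²` (reflection preserves Lebesgue measure)
  have hAneg : MemLp (fun t : ℝ => ∑ a, mellin (f a) (-((((1 / 2 : ℝ)) : ℂ) + ((-t : ℝ) : ℂ) * I)) • φ a) 2 (volume : Measure ℝ) :=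
    hA.comp_measurePreserving (Measure.measurePreserving_neg (volume : Measure ℝ))
  -- the intertwined reflected transform: continuous (finite expansion) and pointwise of the same norm
  have hform : (fun t : ℝ => M ((((1 / 2 : ℝ)) : ℂ) + ((-t : ℝ) : ℂ) * I) (∑ a, mellin (f a) (-((((1 / 2 : ℝ)) : ℂ) + ((-t : ℝ) : ℂ) * I)) • φ a)) =
      fun t : ℝ => ∑ a, mellin (f a) (-((((1 / 2 : ℝ)) : ℂ) + ((-t : ℝ) : ℂ) * I)) • M ((((1 / 2 : ℝ)) : ℂ) + ((-t : ℝ) : ℂ) * I) (φ a) := by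
    funext t
    simp only [_root_.map_sum, _root_.map_smul]
  have hcontM : Continuous fun t : ℝ => M ((((1 / 2 : ℝ)) : ℂ) + ((-t : ℝ) : ℂ) * I) (∑ a, mellin (f a) (-((((1 / 2 : ℝ)) : ℂ) + ((-t : ℝ) : ℂ) * I)) • φ a) := by
    rw [hform]
    exact continuous_finsetSum _ fun a _ =>
      ((continuous_mellin_neg_axis (hf a).continuous (hfs a) (hf0 a)).comp continuous_neg).smul ((hcont (φ a)).comp continuous_neg)
  have hMneg : MemLp (fun t : ℝ => M ((((1 / 2 : ℝ)) : ℂ) + ((-t : ℝ) : ℂ) * I) (∑ a, mellin (f a) (-((((1 / 2 : ℝ)) : ℂ) + ((-t : ℝ) : ℂ) * I)) • φ a)) 2 (volume : Measure ℝ) :=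
    MemLp.of_le hAneg hcontM.aestronglyMeasurable (Eventually.of_forall fun t => (norm_map_eq_of_inner_map_map (hc1 (-t)) _).le)
  exact (hA.add hMneg).restrict (Ioi 0)

/-! ## §2 HEAD: the self-dual block isometry on letters -/

/-- **THE PLANCHEREL ISOMETRY OF A SELF-DUAL BLOCK, ON LETTERS (ROADCARD §3′ D4′c (SD)).**  Data: a finite-dimensional complex inner-product space `V` (a model of `V(χ, K′, ω)`), vectors
`φ_a ∈ V` (`a ∈ α` finite), a family `x : ι → H` in a complex inner-product space (E1: `[θ_{Ψ_i}] ∈ L²(X,μ)`, `Ψ_i = Σ_a f_{i,a} ⊗ φ_a`, `f_{i,a} ∈ C²_c((0,∞))`), an operator datum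
`M : ℂ → End V` and residue operators `R : ℝ → End V`.  LETTERS: (i) MS ENTRIES `hs`∕`hr`∕`hB` for `z ↦ ⟪φ_b, M(z)φ_a⟫` on an open `U ⊇ {½ ≤ Re z ≤ σ₀}` off a finset `S ⊂ (½, σ₀)` of real
poles (★ T4b-multi's currency, per entry); (ii) RESIDUE POSITIVITY `hRsymm`∕`hRpos` on `S`; (iii) FE∕ADJOINT off a co-discrete `P` (`hPcd`, `hFE : M(1−z)(M(z)v) = v`, `hadj : ⟪x, M(z)y⟫ =
⟪M(z̄)x, y⟫`) and AXIS CONTINUITY `hcont`; (iv) the TWO-TERM GRAM LETTER on `Re z = σ₀` in vector currency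
`hGram : ⟪x_i, x_j⟫ = C·((2π)⁻¹·∫_ℝ (⟪Ψ̂_i(−(1−z̄)), Ψ̂_j(−z)⟫ + ⟪Ψ̂_i(−z̄), M(z)Ψ̂_j(−z)⟫) dy)`, `C ≥ 0`.  CONCLUSION: there are residue model vectors `r_i ∈ ⊕_{c∈S} V` with
`⟪r_i, r_j⟫ = C·Σ_{c∈S} ⟪Ψ̂_i(−c), R_c Ψ̂_j(−c)⟫`, axis model vectors `w_i ∈ L²((0,∞); V)` representing `U_i(t) = Ψ̂_i(−(½+it)) + M(½−it)Ψ̂_i(−(½−it))`, and a LINEAR ISOMETRY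
**`U : closure span {x_i} →ₗᵢ[ℂ] (⊕_{c∈S} V) ⊕₂ L²((0,∞); V)` with `U x_i = (r_i, √(C∕2π) • w_i)`**.  Assembly: ★ part 2 (contour shift) ∘ ★ part 4a (residue Gram) ∘ ★ part 3
(unitary axis) ∘ ★ part 1 (`⊕`-isometry over ★ P3a). [cite: MoeglinWaldspurger1995, II.2.4, IV.3.12] [cite: Langlands1976, §7] [cite: Iwaniec2002, §7.3] -/
theorem exists_linearIsometry_selfDual_of_letters [FiniteDimensional ℂ V] {H : Type*} [NormedAddCommGroup H] [InnerProductSpace ℂ H]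
    {ι α : Type*} [Fintype α] {f : ι → α → ℝ → ℂ}
    (hf : ∀ i a, ContDiff ℝ 2 (f i a)) (hfs : ∀ i a, HasCompactSupport (f i a)) (hf0 : ∀ i a, tsupport (f i a) ⊆ Ioi 0)
    (φ : α → V) (M : ℂ → V →ₗ[ℂ] V) {σ₀ : ℝ} (hσ₀ : 1 / 2 < σ₀)
    {U : Set ℂ} (hUo : IsOpen U) (hUs : {z : ℂ | 1 / 2 ≤ z.re ∧ z.re ≤ σ₀} ⊆ U) (S : Finset ℝ) (hS : ∀ c ∈ S, 1 / 2 < c ∧ c < σ₀)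
    (hs : ∀ a b, DifferentiableOn ℂ (fun z : ℂ => ⟪φ b, M z (φ a)⟫_ℂ) (U \ ((S.image fun c : ℝ => (c : ℂ)) : Set ℂ)))
    (R : ℝ → V →ₗ[ℂ] V) (hr : ∀ a b, ∀ c ∈ S, Tendsto (fun z : ℂ => (z - c) * ⟪φ b, M z (φ a)⟫_ℂ) (𝓝[≠] (c : ℂ)) (𝓝 ⟪φ b, R c (φ a)⟫_ℂ))
    {B : ℝ} (hB : ∀ a b, ∀ z : ℂ, 1 / 2 < z.re → z.re ≤ σ₀ → 1 ≤ |z.im| → ‖⟪φ b, M z (φ a)⟫_ℂ‖ ≤ B)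
    (hRsymm : ∀ c ∈ S, ∀ v v' : V, ⟪v, R c v'⟫_ℂ = ⟪R c v, v'⟫_ℂ) (hRpos : ∀ c ∈ S, ∀ v : V, 0 ≤ RCLike.re ⟪v, R c v⟫_ℂ)
    {P : Set ℂ} (hPcd : ∀ z₀ : ℂ, ∀ᶠ w in 𝓝[≠] z₀, w ∉ P)
    (hFE : ∀ z : ℂ, z ∉ P → 1 - z ∉ P → ∀ v : V, M (1 - z) (M z v) = v) (hadj : ∀ z : ℂ, z ∉ P → conj z ∉ P → ∀ v v' : V, ⟪v, M z v'⟫_ℂ = ⟪M (conj z) v, v'⟫_ℂ)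
    (hcont : ∀ v : V, Continuous fun t : ℝ => M ((((1 / 2 : ℝ)) : ℂ) + t * I) v)
    (x : ι → H) {C : ℝ} (hC : 0 ≤ C)
    (hGram : ∀ i j, ⟪x i, x j⟫_ℂ = (C : ℂ) * ((((2 * π)⁻¹ : ℝ) : ℂ) * ∫ y : ℝ,
      (⟪∑ b, mellin (f i b) (-(1 - conj ((σ₀ : ℂ) + y * I))) • φ b, ∑ a, mellin (f j a) (-((σ₀ : ℂ) + y * I)) • φ a⟫_ℂ +
        ⟪∑ b, mellin (f i b) (-conj ((σ₀ : ℂ) + y * I)) • φ b, M ((σ₀ : ℂ) + y * I) (∑ a, mellin (f j a) (-((σ₀ : ℂ) + y * I)) • φ a)⟫_ℂ))) :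
    ∃ (r : ι → PiLp 2 (fun _ : ↥S => V)) (w : ι → Lp V 2 ((volume : Measure ℝ).restrict (Ioi 0)))
      (Uiso : (Submodule.span ℂ (Set.range x)).topologicalClosure →ₗᵢ[ℂ] WithLp 2 (PiLp 2 (fun _ : ↥S => V) × Lp V 2 ((volume : Measure ℝ).restrict (Ioi 0)))),
      (∀ i j, ⟪r i, r j⟫_ℂ = (C : ℂ) * ∑ c ∈ S, ⟪∑ b, mellin (f i b) (-(c : ℂ)) • φ b, R c (∑ a, mellin (f j a) (-(c : ℂ)) • φ a)⟫_ℂ) ∧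
      (∀ i, (w i : ℝ → V) =ᵐ[(volume : Measure ℝ).restrict (Ioi 0)] fun t => (∑ a, mellin (f i a) (-((((1 / 2 : ℝ)) : ℂ) + t * I)) • φ a) +
        M ((((1 / 2 : ℝ)) : ℂ) + ((-t : ℝ) : ℂ) * I) (∑ a, mellin (f i a) (-((((1 / 2 : ℝ)) : ℂ) + ((-t : ℝ) : ℂ) * I)) • φ a)) ∧
      (∀ i, Uiso ⟨x i, mem_topologicalClosure_span x i⟩ = WithLp.toLp 2 (r i, ((Real.sqrt (C * (2 * π)⁻¹) : ℝ) : ℂ) • w i)) := by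
  haveI : CompleteSpace V := FiniteDimensional.complete ℂ V
  -- the axis data
  set A : ι → ℝ → V := fun i t => ∑ a, mellin (f i a) (-((((1 / 2 : ℝ)) : ℂ) + t * I)) • φ a with hA
  set c : ℝ → V → V := fun t => ⇑(M ((((1 / 2 : ℝ)) : ℂ) + t * I)) with hc
  set κ : ℝ := C * (2 * π)⁻¹ with hκ
  have hκ0 : 0 ≤ κ := mul_nonneg hC (inv_nonneg.2 (by positivity))
  -- (iii) ⇒ unitarity and adjoint reflection on the axis (★ part 3)
  obtain ⟨hc1, hcs⟩ := hc1_hcs_of_fe_of_adj (s := fun z => ⇑(M z)) hPcd hFE hadj hcont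
  -- (ii) ⇒ the residue model vectors (★ part 4a)
  obtain ⟨r, hrG⟩ := exists_gram_of_nonneg_finset S R hRsymm hRpos (fun i (c : ℝ) => ∑ a, mellin (f i a) (-(c : ℂ)) • φ a) hC
  -- (i)+(iv) ⇒ the Gram entries on the unitary axis (★ part 2)
  have hshift : ∀ i j, ⟪x i, x j⟫_ℂ = (C : ℂ) * (∑ c ∈ S, ⟪∑ b, mellin (f i b) (-(c : ℂ)) • φ b, R c (∑ a, mellin (f j a) (-(c : ℂ)) • φ a)⟫_ℂ) +
      (C : ℂ) * ((((2 * π)⁻¹ : ℝ) : ℂ) * ∫ y : ℝ,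
        (⟪∑ b, mellin (f i b) (-(1 - conj ((((1 / 2 : ℝ)) : ℂ) + y * I))) • φ b, ∑ a, mellin (f j a) (-((((1 / 2 : ℝ)) : ℂ) + y * I)) • φ a⟫_ℂ +
          ⟪∑ b, mellin (f i b) (-conj ((((1 / 2 : ℝ)) : ℂ) + y * I)) • φ b, M ((((1 / 2 : ℝ)) : ℂ) + y * I) (∑ a, mellin (f j a) (-((((1 / 2 : ℝ)) : ℂ) + y * I)) • φ a)⟫_ℂ)) :=
    fun i j => pseudoEisenstein_contourShift_vector_of_letters (hf j) (hfs j) (hf0 j) (hf i) (hfs i) (hf0 i) hσ₀ φ φ M hUo hUs S hS hs R hr hB (hGram i j)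
  -- the axis integrand in `(A, c)` form (★ part 1 `axis_integrand_eq_op`)
  have hG_eq : ∀ i j (y : ℝ),
      ⟪∑ b, mellin (f i b) (-(1 - conj ((((1 / 2 : ℝ)) : ℂ) + y * I))) • φ b, ∑ a, mellin (f j a) (-((((1 / 2 : ℝ)) : ℂ) + y * I)) • φ a⟫_ℂ +
          ⟪∑ b, mellin (f i b) (-conj ((((1 / 2 : ℝ)) : ℂ) + y * I)) • φ b, M ((((1 / 2 : ℝ)) : ℂ) + y * I) (∑ a, mellin (f j a) (-((((1 / 2 : ℝ)) : ℂ) + y * I)) • φ a)⟫_ℂ =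
        ⟪A i y, A j y⟫_ℂ + ⟪A i (-y), c y (A j y)⟫_ℂ := fun i j y => by
    have key := axis_integrand_eq_op (fun w => ∑ a, mellin (f j a) w • φ a) (fun w => ∑ b, mellin (f i b) w • φ b) (fun z => ⇑(M z)) y
    beta_reduce at key
    rw [key]
  have hGint : ∀ i j, Integrable fun t : ℝ => ⟪A i t, A j t⟫_ℂ + ⟪A i (-t), c t (A j t)⟫_ℂ := fun i j => by
    have h := integrable_vectorIntegrand_vertical (hf j) (hfs j) (hf0 j) (hf i) (hfs i) (hf0 i) hσ₀ φ φ M hUo hUs S (fun c hc => (hS c hc).1) hs hB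
      (σ := 1 / 2) le_rfl hσ₀.le (fun c hc => (hS c hc).1.ne)
    exact h.congr (Eventually.of_forall fun y => hG_eq i j y)
  have hGram' : ∀ i j, ⟪x i, x j⟫_ℂ = ⟪r i, r j⟫_ℂ + (κ : ℂ) * ∫ t : ℝ, (⟪A i t, A j t⟫_ℂ + ⟪A i (-t), c t (A j t)⟫_ℂ) := fun i j => by
    rw [hshift i j, hrG i j, ← integral_congr_ae (Eventually.of_forall (hG_eq i j)), hκ]
    push_cast
    ring
  -- the axis model vectors in `L²((0,∞); V)` (§1)
  have hUmem : ∀ i, MemLp (fun t : ℝ => A i t + c (-t) (A i (-t))) 2 ((volume : Measure ℝ).restrict (Ioi 0)) := fun i =>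
    memLp_two_axisModel_selfDual (hf i) (hfs i) (hf0 i) φ M hc1 hcont
  refine ⟨r, fun i => (hUmem i).toLp _, ?_⟩
  obtain ⟨Uiso, hU⟩ := exists_linearIsometry_of_twoTerm_gram (V := V) (x := x) (r := r) (A := A) (c := c) hc1 hcs hκ0 (fun i => (hUmem i).toLp _)
    (fun i => MemLp.coeFn_toLp _) hGint hGram'
  exact ⟨Uiso, hrG, fun i => MemLp.coeFn_toLp _, hU⟩

/-- **RANGE OF THE SELF-DUAL BLOCK ISOMETRY** (`H` complete, e.g. `L²(X, μ)`): `range U = closure span {(r_i, √(C∕2π) • w_i)}` (★ part 1 `range_linearIsometry_of_twoTerm_gram`).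
[cite: ReedSimonI1980, Thm. I.7] -/
theorem range_linearIsometry_selfDual {H : Type*} [NormedAddCommGroup H] [InnerProductSpace ℂ H] [CompleteSpace H] {ι : Type*} {S : Finset ℝ}
    (x : ι → H) (r : ι → PiLp 2 (fun _ : ↥S => V)) {C : ℝ} (w : ι → Lp V 2 ((volume : Measure ℝ).restrict (Ioi 0)))
    (Uiso : (Submodule.span ℂ (Set.range x)).topologicalClosure →ₗᵢ[ℂ] WithLp 2 (PiLp 2 (fun _ : ↥S => V) × Lp V 2 ((volume : Measure ℝ).restrict (Ioi 0))))
    (hU : ∀ i, Uiso ⟨x i, mem_topologicalClosure_span x i⟩ = WithLp.toLp 2 (r i, ((Real.sqrt (C * (2 * π)⁻¹) : ℝ) : ℂ) • w i)) :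
    Set.range Uiso = ((Submodule.span ℂ (Set.range fun i => WithLp.toLp 2 (r i, ((Real.sqrt (C * (2 * π)⁻¹) : ℝ) : ℂ) • w i))).topologicalClosure :
      Set (WithLp 2 (PiLp 2 (fun _ : ↥S => V) × Lp V 2 ((volume : Measure ℝ).restrict (Ioi 0))))) :=
  range_linearIsometry_of_twoTerm_gram (V := V) x r w Uiso hU

end Summit.HodgeConjecture.HodgeConjecture.Cruxes.H413.K2E1ChiSectionPlancherelSelfDualOfLetters

end
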